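import Literature.Topology.FourManifolds.LinkLeeStates
import Literature.Topology.FourManifolds.KhComplexTransportProofs
import HarnessLib

/-!
# Relabelling invariance of the link tower

A link Gauss diagram (`LinkGaussDiagram`; link tower `LinkGaussDiagrams` → `LinkKhResolutions`
→ `LinkKhComplex` → `LinkLeeStates`) carries arbitrary numberings of its `2n` chord ends, its
`n` chords and its `free` chord-free circles; reading a link off a picture gives a diagram only
up to renumbering (GPV (2000), §1). This file proves that nothing in the tower depends on these
numberings — the link analogue of the knot tower's bookkeeping move `GaussDiagram.IsRelabelling`
(`LeeRasmussenProofs`: `rotateTransfer`, `relabelTransfer`, `rasmussenInvariant_relabel`;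
`KhComplexTransportProofs`, `KhFrobeniusRMove`: `nonempty_iso_*Homology_of_isRelabelling`), by
EXACTLY its method (transfer data + Koszul potential + signed re-indexing).

* `relabel τ κ`: the marked point `p` becomes `τ p`, chord `i` becomes chord `κ i`, and the
  successor is conjugated, `next' = τ ∘ next ∘ τ⁻¹`, the order for which `next' (τ p) = τ (next p)`
  (`relabel_next_apply`) and `arcIn`/`arcOut` are transported (`arcEquivRelabel_arcIn/arcOut`).
  A renumbering `φ` of the free circles is invisible on the diagram (they carry no data) and
  enters only the transport of arcs and enhanced states (`arcEquivRelabel τ κ φ = Sum.map τ φ`).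
  `relabel_one`, `relabel_relabel` (`rfl`), `relabel_unknots`, `relabel_saddle` (births and
  deaths commute with `relabel` by `rfl`); the knot tower's `GaussDiagram.relabel π` is
  `relabel 1 π⁻¹` and `GaussDiagram.rotate k` is `relabel ((finRotate (2n)) ^ k) 1` on the image
  of `ofGaussDiagram` (`ofGaussDiagram_relabel`, `rfl`; `ofGaussDiagram_rotate`).
* `IsRelabelling L L' := ∃ τ κ, L' = L.relabel τ κ` (no cast: `n`, `free` agree definitionally),
  an equivalence relation; `isRelabelling_ofGaussDiagram` from `GaussDiagram.IsRelabelling`.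
* TRANSPORT, packaged as in the knot tower by `Transfer L L'` (chord bijection + arc bijection
  compatible with signs, reconnection relations and local strands — verbatim port of
  `GaussDiagram.Transfer` with its API `stateMap`, `graphIso`, `circleEquiv`,
  `circleOf_arc_eq_iff`, `enhancedEquiv`, `homDegree/qDegree_enhancedMap`,
  `isMergeAt/isSplitAt_iff`, `incidence_enhancedMap`) and its instance `relabelTransfer τ κ φ`
  (arcs `arcEquivRelabel`, states `σ ∘ κ⁻¹`; `stateAdj_relabel`, `isMergeAt/isSplitAt_relabel_iff`,
  `enhancedStateRelabelEquiv`, `incidence_enhancedStateRelabelEquiv` WITH the Koszul sign).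
* THE KOSZUL SIGN. `edgeSign σ i = (-1) ^ #{j < i | σ j = 1}` depends on the ORDER of the chords,
  so `κ` changes the signs of the cube; as in the knot tower (`koszulSwap`, `edgeSign_swap`,
  reached through the forgetful `toGaussDiagram`) the change is the coboundary
  `ε σ · ε (σ[i ↦ 1])` of a potential `ε = ±1` on states. We get a potential for EVERY `κ` at
  once (`exists_koszulPotential`: adjacent transpositions generate, `closure_swap_adjacent_eq_top`,
  and potentials multiply) and feed it (`Transfer.IsKoszulPotential`) to the signed transport
  `s ↦ ε (s.state) · Φ s` (`transportEquiv` = the knot tower's `signedReindex`;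
  `transportEquiv_comp_khovanovD`, `frobeniusHomologyIsoOfTransport`,
  `khovanovHomologyIsoOfTransport`, `leeSMax_eq_of_transport` — ports of `LeeRasmussenProofs` /
  `KhComplexTransportProofs`, with the link tower's `subquotientEquivOfConj`).
* CONSEQUENCES: `nonempty_iso_frobeniusHomology_relabel`, `nonempty_iso_khovanovHomology_relabel`,
  `leeSMax_relabel`, `rasmussenInvariant_relabel` and their `IsRelabelling` versions;
  `IsCheckerboard.relabel`, `enhancedStateRelabelEquiv_leeState` (Lee's canonical states).

Not here: transport of the Lee monomials `leeMonomial` and of `leeSMin` (not needed yet).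

## References

* M. Goussarov, M. Polyak, O. Viro, *Finite-type invariants of classical and virtual knots*,
  Topology 39 (2000), §1 (Gauss diagrams of knots and links). [cite: GPV2000, §1]
* M. Khovanov, *A categorification of the Jones polynomial*, Duke Math. J. 101 (2000), §3.3
  (the cube complex does not depend on the ordering), §4.2, §7. [cite: Khovanov2000, §3.3]
* J. Rasmussen, *Khovanov homology and the slice genus*, Invent. Math. 182 (2010), §2,
  Def. 3.1, Def. 3.4. [cite: Rasmussen2010, §2]
* D. Bar-Natan, *On Khovanov's categorification of the Jones polynomial*, AGT 2 (2002), §3.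
  [cite: BarNatan2002, §3.2]
* O. Viro, *Khovanov homology, its definitions and ramifications*, Fund. Math. 184 (2004), §2,
  §5. [cite: Viro2004, §5]
-/

open Function Set CategoryTheory

noncomputable section

namespace Literature.Topology.FourManifolds

namespace LinkGaussDiagram

variable (L : LinkGaussDiagram)

/-! ## Relabelling a link Gauss diagram -/

/-- **Relabelling** of a link Gauss diagram by a renumbering `τ` of the `2n` marked points and a
renumbering `κ` of the `n` chords: chord `i` becomes chord `κ i` (the new chord `j` has the ends
and the sign of the old chord `κ⁻¹ j`), the marked point `p` becomes `τ p`, and the successor is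
CONJUGATED, `next' = τ ∘ next ∘ τ⁻¹` (as an `Equiv`: `τ.symm.trans (next.trans τ)`, which is
`τ * next * τ⁻¹` definitionally) — the composition order for which `next' (τ p) = τ (next p)`,
so that `arcOut p`, `arcIn p` go to `arcOut (τ p)`, `arcIn (τ p)`. The chord-free circles carry
no data: their renumbering is invisible here (see `arcEquivRelabel`). GPV (2000), §1.
[cite: GPV2000, §1] -/
def relabel (τ : Equiv.Perm (Fin (2 * L.n))) (κ : Equiv.Perm (Fin L.n)) : LinkGaussDiagram where
  n := L.n
  free := L.free
  overPos := τ ∘ L.overPos ∘ κ.symm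
  underPos := τ ∘ L.underPos ∘ κ.symm
  sign := L.sign ∘ κ.symm
  bijective := by
    rw [← Sum.comp_elim, ← Sum.elim_comp_map]
    exact τ.bijective.comp
      (L.bijective.comp (Sum.map_bijective.2 ⟨κ.symm.bijective, κ.symm.bijective⟩))
  next := τ.symm.trans (L.next.trans τ)

section RelabelBasic

variable (τ : Equiv.Perm (Fin (2 * L.n))) (κ : Equiv.Perm (Fin L.n))
  (φ : Equiv.Perm (Fin L.free))

/-- Relabelling keeps the number of chords (definitionally; deliberately not `simp`, so that
`simp` does not rewrite the index types of the relabelled diagram). [folklore] -/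
theorem relabel_n : (L.relabel τ κ).n = L.n := rfl

/-- The over-passage of the renumbered chord `κ i` is `τ (overPos i)`. [folklore] -/
@[simp] theorem relabel_overPos_apply (i : Fin L.n) :
    (L.relabel τ κ).overPos (κ i) = τ (L.overPos i) := by
  simp [relabel]

/-- The under-passage of the renumbered chord `κ i` is `τ (underPos i)`. [folklore] -/
@[simp] theorem relabel_underPos_apply (i : Fin L.n) :
    (L.relabel τ κ).underPos (κ i) = τ (L.underPos i) := by
  simp [relabel]

/-- The renumbered chord `κ i` has the sign of chord `i`. [folklore] -/
@[simp] theorem relabel_sign_apply (i : Fin L.n) : (L.relabel τ κ).sign (κ i) = L.sign i := by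
  simp [relabel]

/-- **The successor is transported**: `next' (τ p) = τ (next p)`. [folklore] -/
@[simp] theorem relabel_next_apply (p : Fin (2 * L.n)) :
    (L.relabel τ κ).next (τ p) = τ (L.next p) := by
  show τ (L.next (τ.symm (τ p))) = _
  rw [Equiv.symm_apply_apply]

/-- The predecessor is transported: `next'⁻¹ (τ p) = τ (next⁻¹ p)`. [folklore] -/
@[simp] theorem relabel_next_symm_apply (p : Fin (2 * L.n)) :
    (L.relabel τ κ).next.symm (τ p) = τ (L.next.symm p) := by
  show τ (L.next.symm (τ.symm (τ p))) = _
  rw [Equiv.symm_apply_apply]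

/-- Relabelling by the identities does nothing. [folklore] -/
@[simp] theorem relabel_one : L.relabel 1 1 = L := by
  cases L; rfl

/-- **Relabellings compose**: relabelling by `(τ, κ)` and then by `(τ', κ')` is relabelling by
`(τ' * τ, κ' * κ)` (definitionally). [folklore] -/
theorem relabel_relabel (τ' : Equiv.Perm (Fin (2 * L.n))) (κ' : Equiv.Perm (Fin L.n)) :
    (L.relabel τ κ).relabel τ' κ' = L.relabel (τ' * τ) (κ' * κ) := rfl

/-- **The knot tower's chord renumbering** `GaussDiagram.relabel π` (new chord `j` = old chord
`π j`) is the relabelling `(1, π⁻¹)` of the image (definitionally). [folklore] -/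
theorem ofGaussDiagram_relabel (G : GaussDiagram) (π : Equiv.Perm (Fin G.n)) :
    ofGaussDiagram (G.relabel π) = (ofGaussDiagram G).relabel 1 π.symm := rfl

/-- **The knot tower's change of base point** `GaussDiagram.rotate k` (position `q ↦ q + k`) is
the relabelling `((finRotate (2n)) ^ k, 1)` of the image: the successor `finRotate (2n)`
commutes with its powers, so it survives the conjugation. GPV (2000), §1.2. [cite: GPV2000, §1] -/
theorem ofGaussDiagram_rotate (G : GaussDiagram) (k : ℕ) :
    ofGaussDiagram (G.rotate k) = (ofGaussDiagram G).relabel ((finRotate (2 * G.n)) ^ k) 1 := by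
  have h : finRotate (2 * G.n) = ((finRotate (2 * G.n)) ^ k).symm.trans
      ((finRotate (2 * G.n)).trans ((finRotate (2 * G.n)) ^ k)) := by
    show finRotate (2 * G.n) =
      (finRotate (2 * G.n)) ^ k * finRotate (2 * G.n) * ((finRotate (2 * G.n)) ^ k)⁻¹
    rw [← (Commute.self_pow (finRotate (2 * G.n)) k).eq, mul_inv_cancel_right]
  exact congrArg (fun nx ↦ (⟨G.n, 0, (finRotate (2 * G.n) ^ k) ∘ G.overPos,
    (finRotate (2 * G.n) ^ k) ∘ G.underPos, G.sign, (G.rotate k).bijective, nx⟩ :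
      LinkGaussDiagram)) h

/-- Relabelling the crossingless diagrams `unknots k` does nothing (nothing to renumber).
[folklore] -/
theorem relabel_unknots (k : ℕ) (τ : Equiv.Perm (Fin (2 * (unknots k).n)))
    (κ : Equiv.Perm (Fin (unknots k).n)) : (unknots k).relabel τ κ = unknots k := by
  have hτ : τ = 1 := Equiv.ext fun p ↦ (Nat.not_lt_zero _ p.isLt).elim
  have hκ : κ = 1 := Equiv.ext fun i ↦ (Nat.not_lt_zero _ i.isLt).elim
  subst hτ hκ
  exact relabel_one _

/-- **Relabelling commutes with saddles**: the saddle along the arcs leaving `p`, `q` becomes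
the saddle along the arcs leaving `τ p`, `τ q`, since `τ (next * swap p q) τ⁻¹` is
`next' * swap (τ p) (τ q)` (births and deaths commute with `relabel` by `rfl`). Rasmussen
(2010), §4.1. [cite: Rasmussen2010, §4.1] -/
theorem relabel_saddle (p q : Fin (2 * L.n)) :
    (L.saddle p q).relabel τ κ = (L.relabel τ κ).saddle (τ p) (τ q) := by
  have h : τ * (L.next * Equiv.swap p q) * τ⁻¹ = τ * L.next * τ⁻¹ * Equiv.swap (τ p) (τ q) := by
    rw [Equiv.swap_apply_apply]
    group
  exact congrArg (fun nx ↦ (⟨L.n, L.free, τ ∘ L.overPos ∘ κ.symm, τ ∘ L.underPos ∘ κ.symm,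
    L.sign ∘ κ.symm, (L.relabel τ κ).bijective, nx⟩ : LinkGaussDiagram)) h

/-- **The arcs are transported**: the arc leaving `p` goes to the arc leaving `τ p` and the free
circle `j` to the free circle `φ j` (`Sum.map τ φ` as an equivalence). [folklore] -/
def arcEquivRelabel : L.Arc ≃ (L.relabel τ κ).Arc := Equiv.sumCongr τ φ

/-- The arc leaving `p` goes to the arc leaving `τ p` (definitionally). [folklore] -/
@[simp] theorem arcEquivRelabel_arcOut (p : Fin (2 * L.n)) :
    L.arcEquivRelabel τ κ φ (L.arcOut p) = (L.relabel τ κ).arcOut (τ p) := rfl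

/-- The arc entering `p` goes to the arc entering `τ p` (this is where the composition order
`next' = τ ∘ next ∘ τ⁻¹` is used). [folklore] -/
@[simp] theorem arcEquivRelabel_arcIn (p : Fin (2 * L.n)) :
    L.arcEquivRelabel τ κ φ (L.arcIn p) = (L.relabel τ κ).arcIn (τ p) := by
  simp only [arcIn, relabel_next_symm_apply]
  rfl

/-- The free circle `j` goes to the free circle `φ j` (definitionally). [folklore] -/
@[simp] theorem arcEquivRelabel_inr (j : Fin L.free) :
    L.arcEquivRelabel τ κ φ (.inr j) = .inr (φ j) := rfl

/-- The chord through a moved marked point is the renumbered chord. [folklore] -/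
@[simp] theorem chordOf_relabel (p : Fin (2 * L.n)) :
    (L.relabel τ κ).chordOf (τ p) = κ (L.chordOf p) := by
  obtain ⟨i, rfl | rfl⟩ := L.exists_chord p
  · rw [chordOf_overPos, ← relabel_overPos_apply, chordOf_overPos]
  · rw [chordOf_underPos, ← relabel_underPos_apply, chordOf_underPos]

/-- The partner of a moved marked point is the moved partner. [folklore] -/
@[simp] theorem partner_relabel (p : Fin (2 * L.n)) :
    (L.relabel τ κ).partner (τ p) = τ (L.partner p) := by
  obtain ⟨i, rfl | rfl⟩ := L.exists_chord p
  · rw [partner_overPos, ← relabel_overPos_apply, partner_overPos, relabel_underPos_apply]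
  · rw [partner_underPos, ← relabel_underPos_apply, partner_underPos, relabel_overPos_apply]

/-- The Seifert rule is transported (the new chord `j` is smoothed as `κ⁻¹ j`). [folklore] -/
@[simp] theorem isSeifert_relabel (σ : L.State) (i : Fin L.n) :
    (L.relabel τ κ).isSeifert (σ ∘ ⇑κ.symm) (κ i) = L.isSeifert σ i := by
  simp [isSeifert, relabel]

/-- **The reconnection relation is transported**: in the transported state two transported arcs
are glued iff the original arcs are. Viro (2004), §2. [cite: Viro2004, §2] -/
theorem stateAdj_relabel (σ : L.State) (a b : L.Arc) :
    (L.relabel τ κ).stateAdj (σ ∘ ⇑κ.symm) (L.arcEquivRelabel τ κ φ a)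
      (L.arcEquivRelabel τ κ φ b) ↔ L.stateAdj σ a b := by
  unfold stateAdj
  refine and_congr (L.arcEquivRelabel τ κ φ).injective.ne_iff
    (Equiv.exists_congr τ fun p ↦ ?_).symm
  simp only [chordOf_relabel, partner_relabel, isSeifert_relabel, ← L.arcEquivRelabel_arcIn τ κ φ,
    ← L.arcEquivRelabel_arcOut τ κ φ, Equiv.apply_eq_iff_eq]

end RelabelBasic

/-- Two link Gauss diagrams are **relabellings** of each other if the second is obtained from the
first by renumbering the marked points and the chords (`relabel`; `n` and `free` then agree
definitionally, so no cast is needed). Link analogue of `GaussDiagram.IsRelabelling` (chord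
renumbering and rotation of the base point, `isRelabelling_ofGaussDiagram`). [cite: GPV2000, §1] -/
def IsRelabelling (L L' : LinkGaussDiagram) : Prop :=
  ∃ (τ : Equiv.Perm (Fin (2 * L.n))) (κ : Equiv.Perm (Fin L.n)), L' = L.relabel τ κ

/-- `IsRelabelling` is reflexive. [folklore] -/
theorem IsRelabelling.refl (L : LinkGaussDiagram) : L.IsRelabelling L := ⟨1, 1, L.relabel_one.symm⟩

variable {L} in
/-- `IsRelabelling` is symmetric (relabel back by the inverse permutations). [folklore] -/
theorem IsRelabelling.symm {L' : LinkGaussDiagram} (h : L.IsRelabelling L') :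
    L'.IsRelabelling L := by
  obtain ⟨τ, κ, rfl⟩ := h
  refine ⟨(τ⁻¹ : Equiv.Perm (Fin (2 * L.n))), (κ⁻¹ : Equiv.Perm (Fin L.n)), ?_⟩
  rw [relabel_relabel, inv_mul_cancel, inv_mul_cancel, relabel_one]

variable {L} in
/-- `IsRelabelling` is transitive (relabellings compose, `relabel_relabel`). [folklore] -/
theorem IsRelabelling.trans {L' L'' : LinkGaussDiagram} (h : L.IsRelabelling L')
    (h' : L'.IsRelabelling L'') : L.IsRelabelling L'' := by
  obtain ⟨τ, κ, rfl⟩ := h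
  obtain ⟨τ', κ', rfl⟩ := h'
  change Equiv.Perm (Fin (2 * L.n)) at τ'
  change Equiv.Perm (Fin L.n) at κ'
  exact ⟨τ' * τ, κ' * κ, L.relabel_relabel τ κ τ' κ'⟩

/-- `IsRelabelling` is an equivalence relation. [folklore] -/
theorem isRelabelling_equivalence : Equivalence IsRelabelling :=
  ⟨IsRelabelling.refl, IsRelabelling.symm, IsRelabelling.trans⟩

/-- **The knot tower's relabellings are relabellings**: if `G'` is obtained from `G` by a chord
renumbering and a change of base point (`GaussDiagram.IsRelabelling`), the images in the link
tower are relabellings of each other (`ofGaussDiagram_relabel/rotate`). [cite: GPV2000, §1] -/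
theorem isRelabelling_ofGaussDiagram {G G' : GaussDiagram} (h : G.IsRelabelling G') :
    (ofGaussDiagram G).IsRelabelling (ofGaussDiagram G') := by
  obtain ⟨π, k, rfl⟩ := h
  rw [ofGaussDiagram_rotate]
  exact ⟨(finRotate (2 * G.n)) ^ k, π.symm, rfl⟩

/-! ## Signed transport of the complexes (port of the knot tower's transport lemmas)

Along an equivalence `Φ` of enhanced states and signs `ε s = ±1` with
`⟨d (Φ s), Φ s'⟩ = ε s · ε s' · ⟨d s, s'⟩`, the signed re-indexing `s ↦ ε s · Φ s` is an
isomorphism of complexes (port of `LeeRasmussenProofs`, `KhComplexTransportProofs`, reusing the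
general `GaussDiagram.signedReindex`, `signedReindex_comp_toLin'`, `subquotientEquivOfConj`). -/

section Transport

variable {L} {L' : LinkGaussDiagram} (Φ : L.EnhancedState ≃ L'.EnhancedState)
  (hdeg : ∀ s, homDegree (Φ s) = homDegree s)

/-- An equivalence of enhanced states preserving the homological degree restricts to the bases
`degStates i`. Khovanov (2000), §3.3. [cite: Khovanov2000, §3.3] -/
def transportDegEquiv (i : ℤ) : L.degStates i ≃ L'.degStates i :=
  Φ.subtypeEquiv fun s ↦ by rw [hdeg]

/-- The underlying enhanced state of a transported basis element. [folklore] -/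
@[simp] theorem transportDegEquiv_apply_val (i : ℤ) (s : L.degStates i) :
    (transportDegEquiv Φ hdeg i s).1 = Φ s.1 := rfl

/-- An equivalence of enhanced states preserving both degrees restricts to the bases
`bidegStates i j`. Khovanov (2000), §3.3. [cite: Khovanov2000, §3.3] -/
def transportBidegEquiv (hq : ∀ s, qDegree (Φ s) = qDegree s) (i j : ℤ) :
    L.bidegStates i j ≃ L'.bidegStates i j :=
  Φ.subtypeEquiv fun s ↦ by rw [hdeg, hq]

variable {R : Type} [CommRing R] (ε : L.EnhancedState → R) (hε : ∀ s, ε s * ε s = 1)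

/-- **The signed transport of `i`-cochains** along `Φ` with signs `ε`: the knot tower's
`signedReindex` on the bases `degStates i`, `x ↦ (s' ↦ ε (Φ⁻¹ s') · x (Φ⁻¹ s'))`.
[cite: Khovanov2000, §3.3] -/
def transportEquiv (i : ℤ) : (L.degStates i → R) ≃ₗ[R] (L'.degStates i → R) :=
  GaussDiagram.signedReindex (transportDegEquiv Φ hdeg i) (fun s ↦ ε s.1) fun s ↦ hε s.1

/-- The value of the signed transport. [folklore] -/
@[simp] theorem transportEquiv_apply (i : ℤ) (x : L.degStates i → R) (s' : L'.degStates i) :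
    transportEquiv Φ hdeg ε hε i x s' =
      ε (Φ.symm s'.1) * x ((transportDegEquiv Φ hdeg i).symm s') := rfl

/-- **The signed transport is a chain isomorphism** as soon as
`⟨d (Φ s), Φ s'⟩ = ε s · ε s' · ⟨d s, s'⟩`: `P ∘ d = d' ∘ P` in all degrees
(`signedReindex_comp_toLin'`). Khovanov (2000), §3.3. [cite: Khovanov2000, §3.3] -/
theorem transportEquiv_comp_khovanovD (h t : R)
    (hinc : ∀ s s', L'.incidence R h t (Φ s) (Φ s') = ε s * ε s' * L.incidence R h t s s')
    (i i' : ℤ) :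
    (transportEquiv Φ hdeg ε hε i').toLinearMap ∘ₗ L.khovanovD R h t i i' =
      L'.khovanovD R h t i i' ∘ₗ (transportEquiv Φ hdeg ε hε i).toLinearMap :=
  GaussDiagram.signedReindex_comp_toLin' _ _ _ _ _ _ _ _ fun s s' ↦ hinc s.1 s'.1

/-- **Transport of the homology over `R[X]/(X² - hX - t)`** along a signed equivalence of
enhanced states: `H^i(L) ≅ H^i(L')` (`subquotientEquivOfConj`; no `d² = 0` needed).
[cite: Khovanov2000, §3.3] -/
def frobeniusHomologyIsoOfTransport (h t : R)
    (hinc : ∀ s s', L'.incidence R h t (Φ s) (Φ s') = ε s * ε s' * L.incidence R h t s s')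
    (i : ℤ) : L.frobeniusHomology R h t i ≅ L'.frobeniusHomology R h t i :=
  LinearEquiv.toModuleIso (subquotientEquivOfConj _ _ _ _
    (transportEquiv Φ hdeg ε hε (i - 1)) (transportEquiv Φ hdeg ε hε i)
    (transportEquiv Φ hdeg ε hε (i + 1))
    (transportEquiv_comp_khovanovD Φ hdeg ε hε h t hinc (i - 1) i).symm
    (transportEquiv_comp_khovanovD Φ hdeg ε hε h t hinc i (i + 1)).symm)

/-- **The bigraded signed transport** (`h = t = 0`, over `ℤ`) on the bases `bidegStates i j`.
Khovanov (2000), §3.3. [cite: Khovanov2000, §3.3] -/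
def transportEquivQ (hq : ∀ s, qDegree (Φ s) = qDegree s) (c : L.EnhancedState → ℤ)
    (hc : ∀ s, c s * c s = 1) (i j : ℤ) :
    (L.bidegStates i j → ℤ) ≃ₗ[ℤ] (L'.bidegStates i j → ℤ) :=
  GaussDiagram.signedReindex (transportBidegEquiv Φ hdeg hq i j) (fun s ↦ c s.1) fun s ↦ hc s.1

/-- The bigraded signed transport intertwines the differentials. [cite: Khovanov2000, §3.3] -/
theorem transportEquivQ_comp_khovanovDQ (hq : ∀ s, qDegree (Φ s) = qDegree s)
    (c : L.EnhancedState → ℤ) (hc : ∀ s, c s * c s = 1)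
    (hinc : ∀ s s', L'.incidence ℤ 0 0 (Φ s) (Φ s') = c s * c s' * L.incidence ℤ 0 0 s s')
    (i i' j : ℤ) :
    (transportEquivQ Φ hdeg hq c hc i' j).toLinearMap ∘ₗ L.khovanovDQ i i' j =
      L'.khovanovDQ i i' j ∘ₗ (transportEquivQ Φ hdeg hq c hc i j).toLinearMap :=
  GaussDiagram.signedReindex_comp_toLin' _ _ _ _ _ _ _ _ fun s s' ↦ hinc s.1 s'.1

/-- **Transport of bigraded Khovanov homology** `Kh^{i,j}(L) ≅ Kh^{i,j}(L')` along a signed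
equivalence preserving both degrees and the integral incidences. [cite: Khovanov2000, §3.3] -/
def khovanovHomologyIsoOfTransport (hq : ∀ s, qDegree (Φ s) = qDegree s)
    (c : L.EnhancedState → ℤ) (hc : ∀ s, c s * c s = 1)
    (hinc : ∀ s s', L'.incidence ℤ 0 0 (Φ s) (Φ s') = c s * c s' * L.incidence ℤ 0 0 s s')
    (i j : ℤ) : L.khovanovHomology i j ≅ L'.khovanovHomology i j :=
  LinearEquiv.toModuleIso (subquotientEquivOfConj _ _ _ _
    (transportEquivQ Φ hdeg hq c hc (i - 1) j) (transportEquivQ Φ hdeg hq c hc i j)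
    (transportEquivQ Φ hdeg hq c hc (i + 1) j)
    (transportEquivQ_comp_khovanovDQ Φ hdeg hq c hc hinc (i - 1) i j).symm
    (transportEquivQ_comp_khovanovDQ Φ hdeg hq c hc hinc i (i + 1) j).symm)

/-- **Filtered maps do not decrease `s_max`** (port of the knot tower's lemma): a map of Lee
cycles killing no nonzero class and not decreasing `qMin` gives `s_max(L) ≤ s_max(L')`.
[cite: Rasmussen2010, §2] -/
theorem leeSMax_le_of_filtered (ψ : L.leeCycles → L'.leeCycles)
    (hinj : ∀ z : L.leeCycles, (Submodule.Quotient.mk (ψ z) : L'.LeeHomologyZero) = 0 →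
      (Submodule.Quotient.mk z : L.LeeHomologyZero) = 0)
    (hfilt : ∀ z : L.leeCycles, qMin z.1 ≤ qMin (ψ z).1) : L.leeSMax ≤ L'.leeSMax := by
  refine iSup₂_le fun α hα ↦ iSup₂_le fun z hz ↦ ?_
  have hz : Submodule.Quotient.mk z = α := hz
  have hne : (Submodule.Quotient.mk (ψ z) : L'.LeeHomologyZero) ≠ 0 := fun h0 ↦
    hα (hz ▸ hinj z h0)
  exact (hfilt z).trans
    (le_iSup₂_of_le (Submodule.Quotient.mk (ψ z)) hne (le_iSup₂_of_le (ψ z) rfl le_rfl))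

/-- Intertwining passes to the inverses: `Q ∘ f = f' ∘ P` gives `Q⁻¹ ∘ f' = f ∘ P⁻¹`. [folklore] -/
theorem symm_comp_eq_comp_symm {M M' N N' : Type*} [AddCommGroup M] [Module R M]
    [AddCommGroup M'] [Module R M'] [AddCommGroup N] [Module R N] [AddCommGroup N']
    [Module R N'] (P : M ≃ₗ[R] M') (Q : N ≃ₗ[R] N') (f : M →ₗ[R] N) (f' : M' →ₗ[R] N')
    (hPQ : Q.toLinearMap ∘ₗ f = f' ∘ₗ P.toLinearMap) :
    Q.symm.toLinearMap ∘ₗ f' = f ∘ₗ P.symm.toLinearMap := by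
  refine LinearMap.ext fun y ↦ Q.injective ?_
  have H := LinearMap.congr_fun hPQ (P.symm y)
  simp only [LinearMap.coe_comp, Function.comp_apply, LinearEquiv.coe_coe,
    LinearEquiv.apply_symm_apply] at H ⊢
  exact H.symm

/-- **`s_max` does not decrease along an isomorphism of Lee complexes around degree `0`**
(linear equivalences in degrees `-1, 0, 1` intertwining `d₋₁`, `d₀`) **preserving `qMin` in
degree `0`**: cycles go to cycles, boundaries come from boundaries. [cite: Rasmussen2010, §2] -/
theorem leeSMax_le_of_intertwining
    (Pm : (L.degStates (0 - 1) → ℚ) ≃ₗ[ℚ] (L'.degStates (0 - 1) → ℚ))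
    (P0 : (L.degStates 0 → ℚ) ≃ₗ[ℚ] (L'.degStates 0 → ℚ))
    (P1 : (L.degStates (0 + 1) → ℚ) ≃ₗ[ℚ] (L'.degStates (0 + 1) → ℚ))
    (hm : P0.toLinearMap ∘ₗ L.leeD (0 - 1) 0 = L'.leeD (0 - 1) 0 ∘ₗ Pm.toLinearMap)
    (h0 : P1.toLinearMap ∘ₗ L.leeD 0 (0 + 1) = L'.leeD 0 (0 + 1) ∘ₗ P0.toLinearMap)
    (hq : ∀ x, qMin (P0 x) = qMin x) : L.leeSMax ≤ L'.leeSMax := by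
  have hψ : ∀ z : L.leeCycles, P0 z.1 ∈ L'.leeCycles := fun z ↦ by
    have H := LinearMap.congr_fun h0 z.1
    simp only [LinearMap.coe_comp, Function.comp_apply, LinearEquiv.coe_coe] at H
    rw [LinearMap.mem_ker, ← H, LinearMap.mem_ker.1 z.2, map_zero]
  refine leeSMax_le_of_filtered (fun z ↦ ⟨P0 z.1, hψ z⟩) (fun z hz0 ↦ ?_) fun z ↦ (hq z.1).ge
  rw [Submodule.Quotient.mk_eq_zero, Submodule.mem_comap, LinearMap.mem_range] at hz0 ⊢
  obtain ⟨y', hy'⟩ := hz0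
  refine ⟨Pm.symm y', P0.injective ?_⟩
  have H := LinearMap.congr_fun hm (Pm.symm y')
  simp only [LinearMap.coe_comp, Function.comp_apply, LinearEquiv.coe_coe,
    LinearEquiv.apply_symm_apply] at H
  rw [Submodule.subtype_apply, H, hy']
  rfl

/-- **`s_max` is invariant under an isomorphism of Lee complexes around degree `0` preserving
`qMin`** (both directions of `leeSMax_le_of_intertwining`). [cite: Rasmussen2010, §2] -/
theorem leeSMax_eq_of_intertwining
    (Pm : (L.degStates (0 - 1) → ℚ) ≃ₗ[ℚ] (L'.degStates (0 - 1) → ℚ))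
    (P0 : (L.degStates 0 → ℚ) ≃ₗ[ℚ] (L'.degStates 0 → ℚ))
    (P1 : (L.degStates (0 + 1) → ℚ) ≃ₗ[ℚ] (L'.degStates (0 + 1) → ℚ))
    (hm : P0.toLinearMap ∘ₗ L.leeD (0 - 1) 0 = L'.leeD (0 - 1) 0 ∘ₗ Pm.toLinearMap)
    (h0 : P1.toLinearMap ∘ₗ L.leeD 0 (0 + 1) = L'.leeD 0 (0 + 1) ∘ₗ P0.toLinearMap)
    (hq : ∀ x, qMin (P0 x) = qMin x) : L'.leeSMax = L.leeSMax := by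
  refine le_antisymm ?_ (leeSMax_le_of_intertwining Pm P0 P1 hm h0 hq)
  exact leeSMax_le_of_intertwining Pm.symm P0.symm P1.symm
    (symm_comp_eq_comp_symm Pm P0 _ _ hm) (symm_comp_eq_comp_symm P0 P1 _ _ h0)
    fun y ↦ by rw [← hq (P0.symm y), LinearEquiv.apply_symm_apply]

/-- The signed transport along an equivalence preserving the quantum degree preserves `qMin`
(supports correspond under `Φ`, the signs are units). Rasmussen (2010), §2.1.
[cite: Rasmussen2010, §2] -/
theorem qMin_transportEquiv (ε : L.EnhancedState → ℚ) (hε : ∀ s, ε s * ε s = 1)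
    (hq : ∀ s, qDegree (Φ s) = qDegree s) (x : L.degStates 0 → ℚ) :
    qMin (transportEquiv Φ hdeg ε hε 0 x) = qMin x := by
  unfold qMin
  rw [← (transportDegEquiv Φ hdeg 0).iInf_comp]
  refine iInf_congr fun s ↦ ?_
  have hεs : ε s.1 ≠ 0 := left_ne_zero_of_mul_eq_one (hε s.1)
  simp only [Set.mem_setOf_eq, transportEquiv_apply, transportDegEquiv_apply_val,
    Equiv.symm_apply_apply, hq, ne_eq, mul_eq_zero, hεs, false_or]

include hdeg in
/-- **`s_max` is invariant under signed transport** along an equivalence of enhanced states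
preserving both degrees and the Lee incidence numbers up to the signs. [cite: Rasmussen2010, §2] -/
theorem leeSMax_eq_of_transport (ε : L.EnhancedState → ℚ) (hε : ∀ s, ε s * ε s = 1)
    (hq : ∀ s, qDegree (Φ s) = qDegree s)
    (hinc : ∀ s s', L'.incidence ℚ 0 1 (Φ s) (Φ s') = ε s * ε s' * L.incidence ℚ 0 1 s s') :
    L'.leeSMax = L.leeSMax :=
  leeSMax_eq_of_intertwining (transportEquiv Φ hdeg ε hε (0 - 1))
    (transportEquiv Φ hdeg ε hε 0) (transportEquiv Φ hdeg ε hε (0 + 1))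
    (transportEquiv_comp_khovanovD Φ hdeg ε hε 0 1 hinc (0 - 1) 0)
    (transportEquiv_comp_khovanovD Φ hdeg ε hε 0 1 hinc 0 (0 + 1))
    (qMin_transportEquiv Φ hdeg ε hε hq)

end Transport

/-! ## Transfer data between link Gauss diagrams (port of `GaussDiagram.Transfer`) -/

/-- **Transfer data** between two link Gauss diagrams: a bijection of chords preserving signs
and a bijection of arcs which, for every state transported along the chord bijection, carries
the reconnection relation of `L` onto that of `L'` and the two local strands `arcIn (overPos i)`,
`arcOut (overPos i)` at every chord onto those at the corresponding chord. A relabelling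
`(τ, κ, φ)` gives such data (`relabelTransfer`). Verbatim `GaussDiagram.Transfer`. [folklore] -/
structure Transfer (L L' : LinkGaussDiagram) where
  /-- The bijection of chords. -/
  chord : Fin L.n ≃ Fin L'.n
  /-- The bijection of arcs. -/
  arc : L.Arc ≃ L'.Arc
  /-- Corresponding chords have the same sign. -/
  sign_chord : ∀ i, L'.sign (chord i) = L.sign i
  /-- The arc bijection carries the reconnection relation of every state to that of the
  transported state. -/
  stateAdj_iff : ∀ (σ : L.State) (a b : L.Arc),
    L'.stateAdj (σ ∘ chord.symm) (arc a) (arc b) ↔ L.stateAdj σ a b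
  /-- The incoming local strands correspond. -/
  arcIn_overPos : ∀ i, L'.arcIn (L'.overPos (chord i)) = arc (L.arcIn (L.overPos i))
  /-- The outgoing local strands correspond. -/
  arcOut_overPos : ∀ i, L'.arcOut (L'.overPos (chord i)) = arc (L.arcOut (L.overPos i))

namespace Transfer

variable {L} {L' : LinkGaussDiagram} (T : Transfer L L')

/-- The transported state: chord `T.chord i` of `L'` is smoothed as chord `i` of `L`.
[folklore] -/
def stateMap (σ : L.State) : L'.State := σ ∘ T.chord.symm

/-- The value of the transported state. [folklore] -/
@[simp] theorem stateMap_apply (σ : L.State) (j : Fin L'.n) :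
    T.stateMap σ j = σ (T.chord.symm j) := rfl

/-- The transported state at the corresponding chord. [folklore] -/
theorem stateMap_apply_chord (σ : L.State) (i : Fin L.n) : T.stateMap σ (T.chord i) = σ i := by
  simp [stateMap]

/-- Transport of states commutes with flipping a smoothing. [folklore] -/
theorem stateMap_update (σ : L.State) (i : Fin L.n) (b : Bool) :
    T.stateMap (Function.update σ i b) = Function.update (T.stateMap σ) (T.chord i) b := by
  ext j
  by_cases hj : j = T.chord i
  · subst hj; simp [stateMap]
  · have : T.chord.symm j ≠ i := fun h ↦ hj (by rw [← h, Equiv.apply_symm_apply])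
    simp [stateMap, Function.update_of_ne hj, Function.update_of_ne this]

/-- Transporting a state of `L'` back and forth is the identity. [folklore] -/
@[simp] theorem stateMap_comp_chord (σ' : L'.State) : T.stateMap (σ' ∘ T.chord) = σ' := by
  ext j; simp [stateMap]

/-- Transport of states preserves the weight. Bar-Natan (2002), §3.1.
[cite: BarNatan2002, §3.1] -/
theorem weight_stateMap (σ : L.State) : (T.stateMap σ).weight = σ.weight := by
  unfold State.weight
  exact Finset.card_equiv T.chord.symm fun j ↦ by simp [stateMap]

include T in
/-- Transfer data preserve the number of positive crossings. [folklore] -/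
theorem nPlus_eq : L'.nPlus = L.nPlus := by
  refine Finset.card_equiv T.chord.symm fun j ↦ ?_
  simp only [Finset.mem_filter, Finset.mem_univ, true_and]
  rw [← T.sign_chord, Equiv.apply_symm_apply]

include T in
/-- Transfer data preserve the number of negative crossings. [folklore] -/
theorem nMinus_eq : L'.nMinus = L.nMinus := by
  refine Finset.card_equiv T.chord.symm fun j ↦ ?_
  simp only [Finset.mem_filter, Finset.mem_univ, true_and]
  rw [← T.sign_chord, Equiv.apply_symm_apply]

/-- The Seifert rule is transported. [folklore] -/
theorem isSeifert_stateMap (σ : L.State) (i : Fin L.n) :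
    L'.isSeifert (T.stateMap σ) (T.chord i) = L.isSeifert σ i := by
  simp [isSeifert, stateMap, T.sign_chord]

/-- The arc bijection is an isomorphism of state graphs. [folklore] -/
def graphIso (σ : L.State) : L.stateGraph σ ≃g L'.stateGraph (T.stateMap σ) where
  toEquiv := T.arc
  map_rel_iff' := by
    intro a b
    simp only [stateGraph, SimpleGraph.fromRel_adj, T.arc.injective.ne_iff]
    rw [stateMap, T.stateAdj_iff σ a b, T.stateAdj_iff σ b a]

/-- The isomorphism of state graphs is the arc bijection. [folklore] -/
@[simp] theorem graphIso_apply (σ : L.State) (a : L.Arc) : T.graphIso σ a = T.arc a := rfl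

/-- The induced bijection of state circles. [folklore] -/
def circleEquiv (σ : L.State) : L.StateCircle σ ≃ L'.StateCircle (T.stateMap σ) :=
  (T.graphIso σ).connectedComponentEquiv

/-- The bijection of state circles sends the circle of an arc to the circle of its image.
[folklore] -/
@[simp] theorem circleEquiv_circleOf (σ : L.State) (a : L.Arc) :
    T.circleEquiv σ (L.circleOf σ a) = L'.circleOf (T.stateMap σ) (T.arc a) := rfl

/-- Two arcs lie on the same state circle iff their images do. [folklore] -/
theorem circleOf_arc_eq_iff (σ : L.State) (a b : L.Arc) :
    L'.circleOf (T.stateMap σ) (T.arc a) = L'.circleOf (T.stateMap σ) (T.arc b) ↔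
      L.circleOf σ a = L.circleOf σ b := by
  rw [← circleEquiv_circleOf, ← circleEquiv_circleOf, (T.circleEquiv σ).injective.eq_iff]

/-- The transported enhanced state: transported state, labels carried along the arc bijection.
Khovanov (2000), §3.3; Viro (2004), §5.1. [cite: Viro2004, §5] -/
def enhancedMap (s : L.EnhancedState) : L'.EnhancedState where
  state := T.stateMap s.state
  label := s.label ∘ T.arc.symm
  label_eq _ _ hab := s.label_eq _ _ ((T.graphIso s.state).symm.map_rel_iff.2 hab)

/-- The inverse transport of enhanced states. [folklore] -/
def enhancedInv (u : L'.EnhancedState) : L.EnhancedState where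
  state := u.state ∘ T.chord
  label := u.label ∘ T.arc
  label_eq a b hab := by
    apply u.label_eq
    simpa using (T.graphIso (u.state ∘ T.chord)).map_rel_iff.2 hab

/-- The state of the transported enhanced state. [folklore] -/
@[simp] theorem enhancedMap_state (s : L.EnhancedState) :
    (T.enhancedMap s).state = T.stateMap s.state := rfl

/-- The labels of the transported enhanced state. [folklore] -/
@[simp] theorem enhancedMap_label (s : L.EnhancedState) :
    (T.enhancedMap s).label = s.label ∘ T.arc.symm := rfl

/-- **Transfer data induce a bijection of enhanced states.** Khovanov (2000), §3.3.
[cite: Khovanov2000, §3.3] -/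
def enhancedEquiv : L.EnhancedState ≃ L'.EnhancedState where
  toFun := T.enhancedMap
  invFun := T.enhancedInv
  left_inv s := EnhancedState.ext' (by ext i; simp [stateMap, enhancedInv]) (by
    ext a; simp [enhancedInv])
  right_inv u := EnhancedState.ext' (by ext j; simp [stateMap, enhancedInv]) (by
    ext a; simp [enhancedInv])

/-- The bijection of enhanced states is `enhancedMap`. [folklore] -/
@[simp] theorem enhancedEquiv_apply (s : L.EnhancedState) : T.enhancedEquiv s = T.enhancedMap s :=
  rfl

/-- The bijection of enhanced states preserves the homological degree. Bar-Natan (2002), §3.2.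
[cite: BarNatan2002, §3.2] -/
theorem homDegree_enhancedMap (s : L.EnhancedState) :
    homDegree (T.enhancedMap s) = homDegree s := by
  simp [homDegree, weight_stateMap, T.nMinus_eq]

/-- The bijection of state circles matches the circles carrying a given label. [folklore] -/
theorem card_filter_label_eq (s : L.EnhancedState) (b : Bool) :
    (Finset.univ.filter fun c' : L'.StateCircle (T.enhancedMap s).state ↦
        ∃ a', L'.circleOf (T.enhancedMap s).state a' = c' ∧ (T.enhancedMap s).label a' = b).card =
      (Finset.univ.filter fun c : L.StateCircle s.state ↦
        ∃ a, L.circleOf s.state a = c ∧ s.label a = b).card := by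
  symm
  refine Finset.card_equiv (T.circleEquiv s.state) fun c ↦ ?_
  simp only [Finset.mem_filter, Finset.mem_univ, true_and]
  constructor
  · rintro ⟨a, rfl, hb⟩
    exact ⟨T.arc a, rfl, by simpa using hb⟩
  · rintro ⟨a', ha', hb⟩
    refine ⟨T.arc.symm a', (T.circleEquiv s.state).injective ?_, by simpa using hb⟩
    rw [circleEquiv_circleOf, Equiv.apply_symm_apply]
    exact ha'

/-- The bijection of enhanced states preserves the quantum degree. Bar-Natan (2002), §3.2.
[cite: BarNatan2002, §3.2] -/
theorem qDegree_enhancedMap (s : L.EnhancedState) : qDegree (T.enhancedMap s) = qDegree s := by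
  unfold qDegree
  rw [T.card_filter_label_eq s false, T.card_filter_label_eq s true, enhancedMap_state,
    weight_stateMap, T.nPlus_eq, T.nMinus_eq]

/-- Merges are transported to merges. Viro (2004), §5.2. [cite: Viro2004, §5.2] -/
theorem isMergeAt_iff (σ : L.State) (i : Fin L.n) :
    L'.IsMergeAt (T.stateMap σ) (T.chord i) ↔ L.IsMergeAt σ i := by
  simp only [IsMergeAt, stateMap_apply_chord, T.arcIn_overPos, T.arcOut_overPos, ne_eq,
    T.circleOf_arc_eq_iff]

/-- Splits are transported to splits. Viro (2004), §5.2. [cite: Viro2004, §5.2] -/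
theorem isSplitAt_iff (σ : L.State) (i : Fin L.n) :
    L'.IsSplitAt (T.stateMap σ) (T.chord i) ↔ L.IsSplitAt σ i := by
  unfold IsSplitAt
  rw [stateMap_apply_chord, ← T.stateMap_update, T.arcIn_overPos, T.arcOut_overPos, ne_eq, ne_eq,
    T.circleOf_arc_eq_iff]

/-- The square of a Koszul sign is `1`. [folklore] -/
theorem edgeSign_mul_self {R : Type} [CommRing R] (σ : L.State) (i : Fin L.n) :
    (edgeSign σ i : R) * edgeSign σ i = 1 := by
  rw [← Int.cast_mul, edgeSign, ← pow_add, ← two_mul, pow_mul]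
  simp

/-- **Incidence numbers are transported up to the Koszul signs**: along the flip of the
`0`-smoothing at chord `i`, `⟨d (Φ s), Φ s'⟩ = sgn'(Φ s, i') · sgn(s, i) · ⟨d s, s'⟩` (`i'` the
corresponding chord): the merge / split coefficient is literally the same, only the Koszul sign
may change. Verbatim port of `GaussDiagram.Transfer.incidence_enhancedMap`. Viro (2004), §5.2;
Khovanov (2000), §3.3. [cite: Khovanov2000, §3.3] -/
theorem incidence_enhancedMap {R : Type} [CommRing R] (h t : R) {s s' : L.EnhancedState}
    {i : Fin L.n} (hi : s.state i = false) (hs' : s'.state = Function.update s.state i true) :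
    L'.incidence R h t (T.enhancedMap s) (T.enhancedMap s') =
      (edgeSign (T.stateMap s.state) (T.chord i) : R) * edgeSign s.state i *
        L.incidence R h t s s' := by
  have hi' : (T.enhancedMap s).state (T.chord i) = false := by simpa using hi
  have hs'' : (T.enhancedMap s').state =
      Function.update (T.enhancedMap s).state (T.chord i) true := by
    simp [hs', stateMap_update]
  rw [incidence_of_flip R h t hi' hs'', incidence_of_flip R h t hi hs']
  have hM := T.isMergeAt_iff s.state i
  have hS := T.isSplitAt_iff s.state i
  simp only [enhancedMap_state] at hM hS ⊢
  have hsq := edgeSign_mul_self (R := R) s.state i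
  -- the local strands and their labels
  have hlab : ∀ u : L.EnhancedState,
      (T.enhancedMap u).label (L'.arcIn (L'.overPos (T.chord i))) =
        u.label (L.arcIn (L.overPos i)) ∧
      (T.enhancedMap u).label (L'.arcOut (L'.overPos (T.chord i))) =
        u.label (L.arcOut (L.overPos i)) := fun u ↦ by
    simp [T.arcIn_overPos, T.arcOut_overPos]
  -- the agreement clauses
  have hcond : ∀ σ : L.State,
      (∀ c', L'.circleOf (T.stateMap σ) c' ≠
          L'.circleOf (T.stateMap σ) (L'.arcIn (L'.overPos (T.chord i))) →
        (T.enhancedMap s').label c' = (T.enhancedMap s).label c') ↔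
      (∀ c, L.circleOf σ c ≠ L.circleOf σ (L.arcIn (L.overPos i)) → s'.label c = s.label c) :=
    fun σ ↦ by
      rw [T.arc.surjective.forall]
      refine forall_congr' fun c ↦ ?_
      simp [T.arcIn_overPos, T.circleOf_arc_eq_iff]
  obtain ⟨ha, hb⟩ := hlab s
  obtain ⟨ha', hb'⟩ := hlab s'
  by_cases h1 : L.IsMergeAt s.state i
  · rw [if_pos h1, if_pos (hM.2 h1)]
    by_cases h2 : ∀ c, L.circleOf s'.state c ≠ L.circleOf s'.state (L.arcIn (L.overPos i)) →
        s'.label c = s.label c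
    · rw [if_pos h2, if_pos ((hcond s'.state).2 h2), ha, hb, ha']
      linear_combination (-(↑(edgeSign (T.stateMap s.state) (T.chord i)) *
        GaussDiagram.mergeCoeff R h t (s.label (L.arcIn (L.overPos i)))
          (s.label (L.arcOut (L.overPos i))) (s'.label (L.arcIn (L.overPos i))))) * hsq
    · rw [if_neg h2, if_neg (mt (hcond s'.state).1 h2), mul_zero]
  · rw [if_neg h1, if_neg (mt hM.1 h1)]
    by_cases h3 : L.IsSplitAt s.state i
    · rw [if_pos h3, if_pos (hS.2 h3)]
      by_cases h4 : ∀ c, L.circleOf s.state c ≠ L.circleOf s.state (L.arcIn (L.overPos i)) →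
          s'.label c = s.label c
      · rw [if_pos h4, if_pos ((hcond s.state).2 h4), ha, ha', hb']
        linear_combination (-(↑(edgeSign (T.stateMap s.state) (T.chord i)) *
          GaussDiagram.splitCoeff R h t (s.label (L.arcIn (L.overPos i)))
            (s'.label (L.arcIn (L.overPos i))) (s'.label (L.arcOut (L.overPos i))))) * hsq
      · rw [if_neg h4, if_neg (mt (hcond s.state).1 h4), mul_zero]
    · rw [if_neg h3, if_neg (mt hS.1 h3), mul_zero]

/-- A **Koszul potential** over `R` for the transfer data: signs `ε σ` (`ε σ * ε σ = 1`) on the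
states of `L` whose coboundary is the change of the Koszul signs along the chord bijection,
`sgn'(σ', i') = ε σ · ε (σ[i ↦ 1]) · sgn(σ, i)` at every `0`-smoothed chord `i` (`hε`, `hsign`
of the knot tower's `Transfer.nonempty_iso_frobeniusHomology`). [cite: Khovanov2000, §3.3] -/
def IsKoszulPotential {R : Type} [CommRing R] (ε : L.State → R) : Prop :=
  (∀ σ, ε σ * ε σ = 1) ∧ ∀ (σ : L.State) (i : Fin L.n), σ i = false →
    (edgeSign (T.stateMap σ) (T.chord i) : R) = ε σ * ε (Function.update σ i true) * edgeSign σ i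

/-- **Incidence numbers along transfer data with a Koszul potential**:
`⟨d (Φ s), Φ s'⟩ = ε s · ε s' · ⟨d s, s'⟩` for ALL pairs of enhanced states (both sides vanish
off single flips). Khovanov (2000), §3.3; Viro (2004), §5.2. [cite: Khovanov2000, §3.3] -/
theorem incidence_enhancedEquiv {R : Type} [CommRing R] (h t : R) {ε : L.State → R}
    (hε : T.IsKoszulPotential ε) (s s' : L.EnhancedState) :
    L'.incidence R h t (T.enhancedEquiv s) (T.enhancedEquiv s') =
      ε s.state * ε s'.state * L.incidence R h t s s' := by
  simp only [enhancedEquiv_apply]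
  by_cases hex : ∃ i, s.state i = false ∧ s'.state = Function.update s.state i true
  · obtain ⟨i, hi, hs'⟩ := hex
    rw [T.incidence_enhancedMap h t hi hs', hε.2 s.state i hi, ← hs']
    have hsq := edgeSign_mul_self (R := R) s.state i
    linear_combination (ε s.state * ε s'.state * L.incidence R h t s s') * hsq
  · rw [incidence_of_not_flip R h t hex, incidence_of_not_flip R h t ?_]
    · ring
    · rintro ⟨j, hj, hj'⟩
      obtain ⟨i, rfl⟩ := T.chord.surjective j
      refine hex ⟨i, by simpa [stateMap] using hj, funext fun k ↦ ?_⟩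
      simpa [stateMap, Function.update_apply, T.chord.injective.eq_iff] using
        congrFun hj' (T.chord k)

/-- **Transfer data with a Koszul potential give an isomorphism of the homology over
`R[X]/(X² - hX - t)`** in every degree (signed transport `s ↦ ε (s.state) · Φ s`,
`frobeniusHomologyIsoOfTransport`). Khovanov (2000), §3.3. [cite: Khovanov2000, §3.3] -/
def frobeniusHomologyIso {R : Type} [CommRing R] (h t : R) {ε : L.State → R}
    (hε : T.IsKoszulPotential ε) (i : ℤ) :
    L.frobeniusHomology R h t i ≅ L'.frobeniusHomology R h t i :=
  frobeniusHomologyIsoOfTransport T.enhancedEquiv (fun s ↦ T.homDegree_enhancedMap s)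
    (fun s ↦ ε s.state) (fun s ↦ hε.1 s.state) h t (T.incidence_enhancedEquiv h t hε) i

/-- **Transfer data with a Koszul potential give an isomorphism of bigraded Khovanov homology**
in every bidegree (`khovanovHomologyIsoOfTransport`). [cite: Khovanov2000, §3.3] -/
def khovanovHomologyIso {ε : L.State → ℤ} (hε : T.IsKoszulPotential ε) (i j : ℤ) :
    L.khovanovHomology i j ≅ L'.khovanovHomology i j :=
  khovanovHomologyIsoOfTransport T.enhancedEquiv (fun s ↦ T.homDegree_enhancedMap s)
    (fun s ↦ T.qDegree_enhancedMap s) (fun s ↦ ε s.state) (fun s ↦ hε.1 s.state)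
    (T.incidence_enhancedEquiv 0 0 hε) i j

/-- **Transfer data with a Koszul potential preserve `s_max`** (the signed transport is a
filtered isomorphism of Lee complexes, `leeSMax_eq_of_transport`). [cite: Rasmussen2010, §2] -/
theorem leeSMax_eq {ε : L.State → ℚ} (hε : T.IsKoszulPotential ε) : L'.leeSMax = L.leeSMax :=
  leeSMax_eq_of_transport T.enhancedEquiv (fun s ↦ T.homDegree_enhancedMap s)
    (fun s ↦ ε s.state) (fun s ↦ hε.1 s.state) (fun s ↦ T.qDegree_enhancedMap s)
    (T.incidence_enhancedEquiv 0 1 hε)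

/-- **Transfer data with a Koszul potential preserve Rasmussen's `s`.** Khovanov (2000), §3.3;
Rasmussen (2010), §2.2, Def. 3.4. [cite: Rasmussen2010, §2] -/
theorem rasmussenInvariant_eq {ε : L.State → ℚ} (hε : T.IsKoszulPotential ε) :
    L'.rasmussenInvariant = L.rasmussenInvariant := by
  rw [rasmussenInvariant, rasmussenInvariant, T.leeSMax_eq hε]

end Transfer

/-! ## The transfer data of a relabelling: transport of states, circles, enhanced states -/

section RelabelTransfer

variable (τ : Equiv.Perm (Fin (2 * L.n))) (κ : Equiv.Perm (Fin L.n))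
  (φ : Equiv.Perm (Fin L.free))

/-- **Transfer data for a relabelling** `(τ, κ, φ)`: the chord renumbering `κ` and the arc
transport `arcEquivRelabel τ κ φ` (`relabel_sign_apply`, `stateAdj_relabel`,
`arcEquivRelabel_arcIn/arcOut`). [folklore] -/
def relabelTransfer : Transfer L (L.relabel τ κ) where
  chord := κ
  arc := L.arcEquivRelabel τ κ φ
  sign_chord := L.relabel_sign_apply τ κ
  stateAdj_iff := L.stateAdj_relabel τ κ φ
  arcIn_overPos i := (congrArg (L.relabel τ κ).arcIn (L.relabel_overPos_apply τ κ i)).trans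
    (L.arcEquivRelabel_arcIn τ κ φ (L.overPos i)).symm
  arcOut_overPos i := (congrArg (L.relabel τ κ).arcOut (L.relabel_overPos_apply τ κ i)).trans
    (L.arcEquivRelabel_arcOut τ κ φ (L.overPos i)).symm

/-- **Merges correspond** under a relabelling. Viro (2004), §5.2. [cite: Viro2004, §5.2] -/
theorem isMergeAt_relabel_iff (σ : L.State) (i : Fin L.n) :
    (L.relabel τ κ).IsMergeAt (σ ∘ ⇑κ.symm) (κ i) ↔ L.IsMergeAt σ i :=
  (L.relabelTransfer τ κ 1).isMergeAt_iff σ i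

/-- **Splits correspond** under a relabelling. Viro (2004), §5.2. [cite: Viro2004, §5.2] -/
theorem isSplitAt_relabel_iff (σ : L.State) (i : Fin L.n) :
    (L.relabel τ κ).IsSplitAt (σ ∘ ⇑κ.symm) (κ i) ↔ L.IsSplitAt σ i :=
  (L.relabelTransfer τ κ 1).isSplitAt_iff σ i

/-- **Enhanced states correspond** under a relabelling: state `σ ∘ κ⁻¹`, labels carried along
`arcEquivRelabel τ κ φ`. Khovanov (2000), §3.3, §4.2. [cite: Khovanov2000, §3.3] -/
def enhancedStateRelabelEquiv : L.EnhancedState ≃ (L.relabel τ κ).EnhancedState :=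
  (L.relabelTransfer τ κ φ).enhancedEquiv

/-- **Incidence numbers under a relabelling, with the Koszul sign**: along a flip at chord
`i`, `⟨d (Φ s), Φ s'⟩ = sgn(σ ∘ κ⁻¹, κ i) · sgn(σ, i) · ⟨d s, s'⟩` — the renumbering `κ` of the
chords changes the Koszul sign `(-1) ^ #{j < i | σ j = 1}` and nothing else. Khovanov (2000),
§3.3. [cite: Khovanov2000, §3.3] -/
theorem incidence_enhancedStateRelabelEquiv {R : Type} [CommRing R] (h t : R)
    {s s' : L.EnhancedState} {i : Fin L.n} (hi : s.state i = false)
    (hs' : s'.state = Function.update s.state i true) :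
    (L.relabel τ κ).incidence R h t (L.enhancedStateRelabelEquiv τ κ φ s)
        (L.enhancedStateRelabelEquiv τ κ φ s') =
      (edgeSign (s.state ∘ ⇑κ.symm) (κ i) : R) * edgeSign s.state i * L.incidence R h t s s' :=
  (L.relabelTransfer τ κ φ).incidence_enhancedMap h t hi hs'

end RelabelTransfer

/-! ## The Koszul potential of a chord renumbering

`edgeSign σ i = (-1) ^ #{j < i | σ j = 1}` depends on the ORDER of the chords, so a chord
renumbering `κ` changes the signs on the cube. As in the knot tower (`GaussDiagram.koszulSwap`,
`GaussDiagram.edgeSign_swap`: for an adjacent transposition the change is the coboundary of the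
potential "`-1` iff both swapped chords are `1`-smoothed"), the change is always a coboundary
`ε σ · ε (σ[i ↦ 1])`: write `κ` as a product of adjacent transpositions, multiply potentials. -/

/-- The knot-style chord data of a link diagram, forgetting `next` and the free circles (a left
inverse of `ofGaussDiagram`; as a KNOT diagram meaningful only when `next = finRotate (2n)`).
Imports the knot tower's chord-order bookkeeping (`edgeSign`, `koszulSwap`, `edgeSign_swap`),
which reads only `n` and the states. [folklore] -/
def toGaussDiagram : GaussDiagram := ⟨L.n, L.overPos, L.underPos, L.sign, L.bijective⟩

/-- The Koszul sign of a link diagram is the knot tower's Koszul sign of its chord data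
(definitionally: same states, same formula). [folklore] -/
theorem edgeSign_eq_toGaussDiagram (σ : L.State) (i : Fin L.n) :
    edgeSign σ i = GaussDiagram.edgeSign (G := L.toGaussDiagram) σ i := rfl

/-- Adjacent transpositions `(a a+1)` generate the symmetric group on `Fin n` (all `n`; from
`Equiv.Perm.mclosure_swap_castSucc_succ`). [folklore] -/
theorem closure_swap_adjacent_eq_top (n : ℕ) :
    Submonoid.closure {κ : Equiv.Perm (Fin n) | ∃ a b : Fin n, (b : ℕ) = a + 1 ∧
      κ = Equiv.swap a b} = ⊤ := by
  cases n with
  | zero =>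
    exact eq_top_iff.2 fun κ _ ↦ by
      rw [show κ = 1 from Equiv.ext fun i ↦ i.elim0]
      exact Submonoid.one_mem _
  | succ m =>
    refine eq_top_iff.2 ((Equiv.Perm.mclosure_swap_castSucc_succ m).symm.le.trans
      (Submonoid.closure_mono ?_))
    rintro _ ⟨a, rfl⟩
    exact ⟨a.castSucc, a.succ, by simp [Fin.val_succ], rfl⟩

/-- **Every chord renumbering has a Koszul potential**: for every permutation `κ` of the chords
there are signs `ε σ = ±1` on the states with `sgn(σ ∘ κ⁻¹, κ i) = ε σ · ε (σ[i ↦ 1]) · sgn(σ, i)`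
at every `0`-smoothed chord `i` — the change of the Koszul signs of the cube under a reordering
of its coordinates is a coboundary. For an adjacent transposition this is the knot tower's
`edgeSign_swap` with `ε = koszulSwap`; potentials of a product multiply,
`ε_{κ₁κ₂}(σ) = ε₂(σ) · ε₁(σ ∘ κ₂⁻¹)`; adjacent transpositions generate. Khovanov (2000), §3.3
(the signed cube complex does not depend on the choices up to isomorphism).
[cite: Khovanov2000, §3.3] -/
theorem exists_koszulPotential (κ : Equiv.Perm (Fin L.n)) :
    ∃ ε : L.State → ℤ, (∀ σ, ε σ * ε σ = 1) ∧ ∀ (σ : L.State) (i : Fin L.n), σ i = false →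
      edgeSign (σ ∘ ⇑κ.symm) (κ i) = ε σ * ε (Function.update σ i true) * edgeSign σ i := by
  let P : Equiv.Perm (Fin L.n) → Prop := fun κ ↦ ∃ ε : L.State → ℤ, (∀ σ, ε σ * ε σ = 1) ∧
    ∀ (σ : L.State) (i : Fin L.n), σ i = false →
      edgeSign (σ ∘ ⇑κ.symm) (κ i) = ε σ * ε (Function.update σ i true) * edgeSign σ i
  have h1 : P 1 := ⟨fun _ ↦ 1, fun _ ↦ rfl, fun σ i _ ↦ by simp only [one_mul]; rfl⟩
  have hmul : ∀ κ₁ κ₂, P κ₁ → P κ₂ → P (κ₁ * κ₂) := by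
    rintro κ₁ κ₂ ⟨ε₁, hε₁, h₁⟩ ⟨ε₂, hε₂, h₂⟩
    refine ⟨fun σ ↦ ε₂ σ * ε₁ (σ ∘ ⇑κ₂.symm), fun σ ↦ ?_, fun σ i hi ↦ ?_⟩
    · calc ε₂ σ * ε₁ (σ ∘ ⇑κ₂.symm) * (ε₂ σ * ε₁ (σ ∘ ⇑κ₂.symm))
          = (ε₂ σ * ε₂ σ) * (ε₁ (σ ∘ ⇑κ₂.symm) * ε₁ (σ ∘ ⇑κ₂.symm)) := by ring
        _ = 1 := by rw [hε₂, hε₁, mul_one]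
    · have hi₂ : (σ ∘ ⇑κ₂.symm) (κ₂ i) = false := by simpa using hi
      have hu : Function.update (σ ∘ ⇑κ₂.symm) (κ₂ i) true =
          Function.update σ i true ∘ ⇑κ₂.symm := by
        rw [Function.update_comp_equiv, Equiv.symm_symm]
      rw [Equiv.Perm.mul_apply, show σ ∘ ⇑(κ₁ * κ₂).symm = (σ ∘ ⇑κ₂.symm) ∘ ⇑κ₁.symm from rfl,
        h₁ _ _ hi₂, hu, h₂ σ i hi]
      ring
  have hswap : ∀ a b : Fin L.n, (b : ℕ) = a + 1 → P (Equiv.swap a b) := fun a b hab ↦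
    ⟨GaussDiagram.koszulSwap (G := L.toGaussDiagram) a b,
      GaussDiagram.koszulSwap_mul_self (G := L.toGaussDiagram) a b, fun σ i hi ↦ by
      rw [Equiv.symm_swap, edgeSign_eq_toGaussDiagram, edgeSign_eq_toGaussDiagram]
      exact GaussDiagram.edgeSign_swap (G := L.toGaussDiagram) a b hab σ i hi⟩
  have hκ : κ ∈ Submonoid.closure {κ : Equiv.Perm (Fin L.n) | ∃ a b : Fin L.n,
      (b : ℕ) = a + 1 ∧ κ = Equiv.swap a b} := by
    rw [closure_swap_adjacent_eq_top]; trivial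
  exact Submonoid.closure_induction (fun κ' hκ' ↦ by
    obtain ⟨a, b, hab, rfl⟩ := hκ'
    exact hswap a b hab) h1 (fun κ₁ κ₂ _ _ e₁ e₂ ↦ hmul κ₁ κ₂ e₁ e₂) hκ

/-! ## Relabelling invariance of the homologies and of Rasmussen's `s` -/

section Invariance

variable (τ : Equiv.Perm (Fin (2 * L.n))) (κ : Equiv.Perm (Fin L.n))

/-- The transfer data of a relabelling admit a Koszul potential over every ring (the potential
of `κ`, `exists_koszulPotential`, cast into `R`). [cite: Khovanov2000, §3.3] -/
theorem exists_isKoszulPotential_relabelTransfer (φ : Equiv.Perm (Fin L.free)) (R : Type)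
    [CommRing R] : ∃ ε : L.State → R, (L.relabelTransfer τ κ φ).IsKoszulPotential ε := by
  obtain ⟨ε, hε, hpot⟩ := L.exists_koszulPotential κ
  refine ⟨fun σ ↦ (ε σ : R), fun σ ↦ by rw [← Int.cast_mul, hε, Int.cast_one], fun σ i hi ↦ ?_⟩
  show ((edgeSign (L := L) (σ ∘ ⇑κ.symm) (κ i) : ℤ) : R) = _
  rw [hpot σ i hi, Int.cast_mul, Int.cast_mul]

/-- **The homology over `R[X]/(X² - hX - t)` of a link Gauss diagram does not depend on the
numbering of its marked points and chords**: `H^i(L.relabel τ κ) ≅ H^i(L)` for every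
`(R, h, t)` and `i` (in particular Lee and Bar-Natan homology) — the signed transport along
`relabelTransfer` with a Koszul potential of `κ`. [cite: Khovanov2000, §3.3] -/
theorem nonempty_iso_frobeniusHomology_relabel {R : Type} [CommRing R] (h t : R) (i : ℤ) :
    Nonempty ((L.relabel τ κ).frobeniusHomology R h t i ≅ L.frobeniusHomology R h t i) := by
  obtain ⟨ε, hε⟩ := L.exists_isKoszulPotential_relabelTransfer τ κ 1 R
  exact ⟨((L.relabelTransfer τ κ 1).frobeniusHomologyIso h t hε i).symm⟩

/-- **Bigraded Khovanov homology does not depend on the numbering**: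
`Kh^{i,j}(L.relabel τ κ) ≅ Kh^{i,j}(L)`. Khovanov (2000), §3.3, §7.
[cite: Khovanov2000, §3.3] -/
theorem nonempty_iso_khovanovHomology_relabel (i j : ℤ) :
    Nonempty ((L.relabel τ κ).khovanovHomology i j ≅ L.khovanovHomology i j) := by
  obtain ⟨ε, hε⟩ := L.exists_isKoszulPotential_relabelTransfer τ κ 1 ℤ
  exact ⟨((L.relabelTransfer τ κ 1).khovanovHomologyIso hε i j).symm⟩

/-- **`s_max` does not depend on the numbering.** Rasmussen (2010), Def. 3.1.
[cite: Rasmussen2010, §2] -/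
theorem leeSMax_relabel : (L.relabel τ κ).leeSMax = L.leeSMax := by
  obtain ⟨ε, hε⟩ := L.exists_isKoszulPotential_relabelTransfer τ κ 1 ℚ
  exact (L.relabelTransfer τ κ 1).leeSMax_eq hε

/-- **Rasmussen's `s` of a link Gauss diagram does not depend on the numbering of its marked
points and chords.** Rasmussen (2010), Def. 3.4, Thm. 1; Khovanov (2000), §3.3.
[cite: Rasmussen2010, §2] -/
theorem rasmussenInvariant_relabel :
    (L.relabel τ κ).rasmussenInvariant = L.rasmussenInvariant := by
  rw [rasmussenInvariant, rasmussenInvariant, leeSMax_relabel]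

variable {L}

/-- **Relabellings have isomorphic homology over every Frobenius system `(R, h, t)`.**
Khovanov (2000), §3.3; Khovanov (2006), §2. [cite: Khovanov2000, §3.3] -/
theorem IsRelabelling.nonempty_iso_frobeniusHomology {L' : LinkGaussDiagram}
    (hL : L.IsRelabelling L') {R : Type} [CommRing R] (h t : R) (i : ℤ) :
    Nonempty (L.frobeniusHomology R h t i ≅ L'.frobeniusHomology R h t i) := by
  obtain ⟨τ, κ, rfl⟩ := hL
  exact (L.nonempty_iso_frobeniusHomology_relabel τ κ h t i).map Iso.symm

/-- **Relabellings have isomorphic bigraded Khovanov homology.** Khovanov (2000), §3.3, Thm. 1.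
[cite: Khovanov2000, §3.3] -/
theorem IsRelabelling.nonempty_iso_khovanovHomology {L' : LinkGaussDiagram}
    (hL : L.IsRelabelling L') (i j : ℤ) :
    Nonempty (L.khovanovHomology i j ≅ L'.khovanovHomology i j) := by
  obtain ⟨τ, κ, rfl⟩ := hL
  exact (L.nonempty_iso_khovanovHomology_relabel τ κ i j).map Iso.symm

/-- **Relabellings have the same Rasmussen invariant.** Rasmussen (2010), Thm. 1.
[cite: Rasmussen2010, §2] -/
theorem IsRelabelling.rasmussenInvariant_eq {L' : LinkGaussDiagram} (hL : L.IsRelabelling L') :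
    L'.rasmussenInvariant = L.rasmussenInvariant := by
  obtain ⟨τ, κ, rfl⟩ := hL
  exact L.rasmussenInvariant_relabel τ κ

end Invariance

/-! ## Checkerboard colourings and Lee's canonical states under a relabelling -/

section Lee

variable {L} (τ : Equiv.Perm (Fin (2 * L.n))) (κ : Equiv.Perm (Fin L.n))
  (φ : Equiv.Perm (Fin L.free))

/-- **Checkerboard colourings are transported**: `c ∘ τ⁻¹` colours the relabelled diagram.
Rasmussen (2010), Lemma 2.4. [cite: Rasmussen2010, §2.3] -/
theorem IsCheckerboard.relabel {c : Fin (2 * L.n) → Bool} (hc : L.IsCheckerboard c) :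
    (L.relabel τ κ).IsCheckerboard (c ∘ ⇑τ.symm) where
  apply_next p' := by
    obtain ⟨p, rfl⟩ := τ.surjective p'
    rw [relabel_next_apply, comp_apply, comp_apply, Equiv.symm_apply_apply,
      Equiv.symm_apply_apply, hc.apply_next]
  apply_underPos j := by
    show c (τ.symm (τ (L.underPos (κ.symm j)))) = !c (τ.symm (τ (L.overPos (κ.symm j))))
    rw [Equiv.symm_apply_apply, Equiv.symm_apply_apply, hc.apply_underPos]

/-- The Seifert state is transported to the Seifert state (definitionally). [folklore] -/
theorem seifertState_relabel : (L.relabel τ κ).seifertState = L.seifertState ∘ ⇑κ.symm := rfl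

/-- **Lee's canonical states are transported to Lee's canonical states**: `leeState hc t u`
goes to the canonical state of the transported colouring `c ∘ τ⁻¹`, the same global flip `t`
and the free-circle labels `u ∘ φ⁻¹`. Rasmussen (2010), §2.3. [cite: Rasmussen2010, §2.3] -/
theorem enhancedStateRelabelEquiv_leeState {c : Fin (2 * L.n) → Bool} (hc : L.IsCheckerboard c)
    (t : Bool) (u : Fin L.free → Bool) :
    L.enhancedStateRelabelEquiv τ κ φ (L.leeState hc t u) =
      (L.relabel τ κ).leeState (hc.relabel τ κ) t (u ∘ ⇑φ.symm) := by
  refine EnhancedState.ext' rfl (funext fun a ↦ ?_)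
  rcases a with q | j <;> rfl

end Lee

end LinkGaussDiagram

end Literature.Topology.FourManifolds

end
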